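import Literature.NumberTheory.Sieve.SmoothParityTernary
import HarnessLib

/-!
# Elementary tools for the model count of the parity ternary problem

Topic `Literature/NumberTheory/Sieve`, namespace `Literature.NumberTheory.Sieve.SmoothArcs`; a PROVED tool file for the
circle-method engine of `SmoothParityTernary` ([Harper2016, §5]).  The model count `parityModelCount` of that file is a
finite triple sum `Σ_{n₁,n₂,n₃} 1[d₁n₁ + σd₂n₂ = n₃] μ₁(n₁) μ₂(n₂) conj μ₃(n₃)` of the model weights
`μ_i(n) = (Mv_i/X_i)(n/X_i)^{α−1} p_{c_i}(n/X_i)` (`SmoothProfileModel`).  Its analysis (rescaling, positivity and size in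
`SmoothParityModelCount`, `SmoothParityModelCountPositivity`; sublattice density in `SmoothParityModelCountDensity`)
rests on the elementary lemmas collected here:

* Kronecker deltas against an integer: `sum_ite_intCast_eq`, `sum_Icc_ite_intCast_eq`, `sum_filter_dvd_ite_intCast_eq`;
* multiples of `t` in `[1, N]`: `sum_filter_dvd_Icc_eq_sum`, `card_filter_dvd_Icc`; `sum_Icc_one_eq_sum_range`,
  `sum_Icc_eq_sum_Icc_of_lt`; the fibre identity `sum_range_mul_comp_div` (`Σ_{a<tK} h(⌊a/t⌋) = t Σ_{k<K} h(k)`), the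
  two-dimensional BLOCK LEMMA `norm_sum_sub_sq_mul_sum_le` (a double sum over `[0,tK₁)×[0,tK₂)` differs from `t²` times
  the sum over one representative per `t×t` block by at most (number of terms) × (oscillation on blocks)) and
  `abs_cast_sub_cast_blockRep_le`;
* the functions `g(v) = v^{α−1} p_c(v)` (`0 ≤ α ≤ 1`) for W-class profiles with `|p_c| ≤ 1`, `p_c = 0` on `v ≤ 1/4`
  and `p_c` Lipschitz: `rpow_sub_one_le_four` (`v^{α−1} ≤ 4` on `[1/4,∞)`), `abs_rpow_sub_one_sub_le`
  (`|v^{α−1} − w^{α−1}| ≤ 16|v−w|` there), `norm_rpow_mul_profileFn_le` (`|g| ≤ 4`), `norm_rpow_mul_profileFn_sub_le`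
  (`g` is `(4L+16)`-Lipschitz on `ℝ`), the three-factor difference bounds `norm_mul_mul_conj_sub_le`,
  `norm_gTerm_sub_le`, and for the model weights `profileModelWeight_eq_mul_rpow_mul` (`μ(n) = (Mv/X) g(n/X)`),
  `norm_profileModelWeight_le_four_mul` (`‖μ(n)‖ ≤ 4Mv/X`).

## References

* A. J. Harper, Compositio Math. 152 (2016), §5 [Harper2016] (context only; the lemmas are folklore).
-/

noncomputable section

open Finset

namespace Literature.NumberTheory.Sieve

namespace SmoothArcs

/-! ### Kronecker deltas against an integer -/

/-- `Σ_{n ∈ S} 1[s = n] F(n) = 1[0 ≤ s, s ∈ S] F(s)` for an integer `s` and `S ⊆ ℕ`. [folklore] -/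
theorem sum_ite_intCast_eq {M : Type*} [AddCommMonoid M] (S : Finset ℕ) (F : ℕ → M) (s : ℤ) :
    ∑ n ∈ S, (if s = (n : ℤ) then F n else 0) = if 0 ≤ s ∧ s.toNat ∈ S then F s.toNat else 0 := by
  by_cases hs : 0 ≤ s
  · obtain ⟨m, rfl⟩ := Int.eq_ofNat_of_zero_le hs
    simp only [Nat.cast_inj, Int.toNat_natCast, hs, true_and]
    exact Finset.sum_ite_eq S m F
  · rw [if_neg (fun h => hs h.1)]
    exact Finset.sum_eq_zero fun n _ => if_neg fun h => by omega

/-- On `[1, N]`: `Σ_{n=1}^{N} 1[s = n] F(n) = 1[1 ≤ s ≤ N] F(s)`. [folklore] -/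
theorem sum_Icc_ite_intCast_eq {M : Type*} [AddCommMonoid M] (N : ℕ) (F : ℕ → M) (s : ℤ) :
    ∑ n ∈ Icc 1 N, (if s = (n : ℤ) then F n else 0) = if 1 ≤ s ∧ s ≤ N then F s.toNat else 0 := by
  rw [sum_ite_intCast_eq]
  by_cases h : 1 ≤ s ∧ s ≤ N
  · rw [if_pos h, if_pos]
    refine ⟨by omega, Finset.mem_Icc.mpr ⟨?_, ?_⟩⟩ <;> omega
  · rw [if_neg h, if_neg]
    rintro ⟨h0, hm⟩
    rw [Finset.mem_Icc] at hm
    omega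

/-- A divisibility filter implied by the delta is redundant: if `t ∣ s` then
`Σ_{n ∈ S, t ∣ n} 1[s = n] F(n) = Σ_{n ∈ S} 1[s = n] F(n)`. [folklore] -/
theorem sum_filter_dvd_ite_intCast_eq {M : Type*} [AddCommMonoid M] (S : Finset ℕ) (F : ℕ → M) {t : ℕ} {s : ℤ}
    (hts : (t : ℤ) ∣ s) :
    ∑ n ∈ S.filter (t ∣ ·), (if s = (n : ℤ) then F n else 0) = ∑ n ∈ S, (if s = (n : ℤ) then F n else 0) := by
  rw [Finset.sum_filter]
  refine Finset.sum_congr rfl fun n _ => ?_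
  by_cases h : s = (n : ℤ)
  · rw [if_pos h, if_pos]
    rw [h] at hts
    exact_mod_cast hts
  · rw [if_neg h, ite_self]

/-! ### Multiples of `t`, shifts of the range, fibres -/

/-- **Reindexing the multiples of `t`**: `Σ_{n ≤ N, t ∣ n} f(n) = Σ_{m ≤ N/t} f(tm)` (`t ≥ 1`). [folklore] -/
theorem sum_filter_dvd_Icc_eq_sum {M : Type*} [AddCommMonoid M] (f : ℕ → M) (N : ℕ) {t : ℕ} (ht : 0 < t) :
    ∑ n ∈ (Icc 1 N).filter (t ∣ ·), f n = ∑ m ∈ Icc 1 (N / t), f (t * m) := by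
  symm
  refine Finset.sum_nbij' (fun m => t * m) (fun n => n / t) ?_ ?_ ?_ ?_ ?_
  · intro m hm
    obtain ⟨h1, h2⟩ := Finset.mem_Icc.mp (Finset.mem_coe.mp hm)
    rw [Nat.le_div_iff_mul_le ht] at h2
    refine Finset.mem_coe.mpr (Finset.mem_filter.mpr ⟨Finset.mem_Icc.mpr ⟨?_, ?_⟩, dvd_mul_right t m⟩)
    · exact le_trans h1 (Nat.le_mul_of_pos_left m ht)
    · rwa [mul_comm]
  · intro n hn
    obtain ⟨hn', hdvd⟩ := Finset.mem_filter.mp (Finset.mem_coe.mp hn)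
    obtain ⟨h1, h2⟩ := Finset.mem_Icc.mp hn'
    exact Finset.mem_coe.mpr (Finset.mem_Icc.mpr ⟨Nat.div_pos (Nat.le_of_dvd h1 hdvd) ht, Nat.div_le_div_right h2⟩)
  · intro m _
    exact Nat.mul_div_cancel_left m ht
  · intro n hn
    obtain ⟨_, hdvd⟩ := Finset.mem_filter.mp (Finset.mem_coe.mp hn)
    exact Nat.mul_div_cancel' hdvd
  · intro m _
    rfl

/-- `#{n ≤ N : t ∣ n} = N/t` (`t ≥ 1`). [folklore] -/
theorem card_filter_dvd_Icc (N : ℕ) {t : ℕ} (ht : 0 < t) : ((Icc 1 N).filter (t ∣ ·)).card = N / t := by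
  rw [Finset.card_eq_sum_ones, sum_filter_dvd_Icc_eq_sum _ N ht, Finset.sum_const, Nat.card_Icc, smul_eq_mul,
    mul_one, Nat.add_sub_cancel]

/-- `Σ_{n=1}^{N} f(n) = Σ_{k<N} f(k+1)`. [folklore] -/
theorem sum_Icc_one_eq_sum_range {M : Type*} [AddCommMonoid M] (f : ℕ → M) (N : ℕ) :
    ∑ n ∈ Icc 1 N, f n = ∑ k ∈ range N, f (k + 1) := by
  induction N with
  | zero => simp
  | succ N ih => rw [Finset.sum_Icc_succ_top (Nat.le_add_left 1 N), ih, Finset.sum_range_succ]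

/-- **Extending the range by vanishing terms**: if `f(n) = 0` for `n > N` then `Σ_{n=1}^{N} f = Σ_{n=1}^{N'} f`
for `N ≤ N'`. [folklore] -/
theorem sum_Icc_eq_sum_Icc_of_lt {M : Type*} [AddCommMonoid M] {f : ℕ → M} {N N' : ℕ} (h : N ≤ N')
    (hf : ∀ n, N < n → f n = 0) : ∑ n ∈ Icc 1 N, f n = ∑ n ∈ Icc 1 N', f n := by
  refine Finset.sum_subset (Finset.Icc_subset_Icc_right h) fun n hn hn' => hf n ?_
  rw [Finset.mem_Icc] at hn
  rw [Finset.mem_Icc] at hn'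
  omega

/-- **Fibres of `a ↦ ⌊a/t⌋`**: `Σ_{a < tK} h(⌊a/t⌋) = t • Σ_{k < K} h(k)`. [folklore] -/
theorem sum_range_mul_comp_div {M : Type*} [AddCommMonoid M] (h : ℕ → M) {t : ℕ} (ht : 0 < t) (K : ℕ) :
    ∑ a ∈ range (t * K), h (a / t) = t • ∑ k ∈ range K, h k := by
  induction K with
  | zero => simp
  | succ K ih =>
    rw [Nat.mul_succ, Finset.sum_range_add, ih, Finset.sum_range_succ, smul_add]
    congr 1
    have hc : ∀ x ∈ range t, h ((t * K + x) / t) = h K := fun x hx => by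
      rw [Nat.mul_add_div ht, Nat.div_eq_of_lt (Finset.mem_range.mp hx), add_zero]
    rw [Finset.sum_congr rfl hc, Finset.sum_const, Finset.card_range]

/-- **The block lemma.**  Tile `[0, tK₁) × [0, tK₂)` into `t × t` blocks, with representatives
`(t⌊a/t⌋ + t − 1, t⌊b/t⌋ + t − 1)`.  If `G` oscillates by at most `B` between any point and the representative of its
block, then `‖Σ_{a<tK₁} Σ_{b<tK₂} G(a,b) − t² Σ_{k₁<K₁} Σ_{k₂<K₂} G(tk₁+t−1, tk₂+t−1)‖ ≤ tK₁ · tK₂ · B`. [folklore] -/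
theorem norm_sum_sub_sq_mul_sum_le (G : ℕ → ℕ → ℂ) {t : ℕ} (ht : 0 < t) (K₁ K₂ : ℕ) {B : ℝ}
    (hB : ∀ a b, ‖G a b - G (t * (a / t) + (t - 1)) (t * (b / t) + (t - 1))‖ ≤ B) :
    ‖∑ a ∈ range (t * K₁), ∑ b ∈ range (t * K₂), G a b -
        (t : ℂ) ^ 2 * ∑ k₁ ∈ range K₁, ∑ k₂ ∈ range K₂, G (t * k₁ + (t - 1)) (t * k₂ + (t - 1))‖ ≤
      ((t * K₁ : ℕ) : ℝ) * ((t * K₂ : ℕ) : ℝ) * B := by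
  have inner : ∀ a : ℕ, ∑ b ∈ range (t * K₂), G (t * (a / t) + (t - 1)) (t * (b / t) + (t - 1)) =
      t • ∑ k₂ ∈ range K₂, G (t * (a / t) + (t - 1)) (t * k₂ + (t - 1)) := fun a =>
    sum_range_mul_comp_div (fun k₂ => G (t * (a / t) + (t - 1)) (t * k₂ + (t - 1))) ht K₂
  have outer : ∑ a ∈ range (t * K₁), t • ∑ k₂ ∈ range K₂, G (t * (a / t) + (t - 1)) (t * k₂ + (t - 1)) =
      t • ∑ k₁ ∈ range K₁, t • ∑ k₂ ∈ range K₂, G (t * k₁ + (t - 1)) (t * k₂ + (t - 1)) :=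
    sum_range_mul_comp_div (fun k₁ => t • ∑ k₂ ∈ range K₂, G (t * k₁ + (t - 1)) (t * k₂ + (t - 1))) ht K₁
  have h2 : (t : ℂ) ^ 2 * ∑ k₁ ∈ range K₁, ∑ k₂ ∈ range K₂, G (t * k₁ + (t - 1)) (t * k₂ + (t - 1)) =
      ∑ a ∈ range (t * K₁), ∑ b ∈ range (t * K₂), G (t * (a / t) + (t - 1)) (t * (b / t) + (t - 1)) := by
    rw [Finset.sum_congr rfl fun a _ => inner a, outer]
    simp_rw [nsmul_eq_mul, Finset.mul_sum]
    refine Finset.sum_congr rfl fun k₁ _ => Finset.sum_congr rfl fun k₂ _ => ?_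
    ring
  rw [h2, ← Finset.sum_sub_distrib]
  calc ‖∑ a ∈ range (t * K₁), (∑ b ∈ range (t * K₂), G a b -
          ∑ b ∈ range (t * K₂), G (t * (a / t) + (t - 1)) (t * (b / t) + (t - 1)))‖
      ≤ ∑ a ∈ range (t * K₁), ((t * K₂ : ℕ) : ℝ) * B := by
        refine norm_sum_le_of_le _ fun a _ => ?_
        rw [← Finset.sum_sub_distrib]
        refine (norm_sum_le_of_le _ fun b _ => hB a b).trans ?_
        rw [Finset.sum_const, Finset.card_range, nsmul_eq_mul]
    _ = ((t * K₁ : ℕ) : ℝ) * ((t * K₂ : ℕ) : ℝ) * B := by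
        rw [Finset.sum_const, Finset.card_range, nsmul_eq_mul, mul_assoc]

/-- Within a block: `a + 1 ≤ t⌊a/t⌋ + t ≤ a + t`, whence `|(a+1) − (t⌊a/t⌋ + t)| ≤ t` (as reals). [folklore] -/
theorem abs_cast_sub_cast_blockRep_le (a : ℕ) {t : ℕ} (ht : 0 < t) :
    |((a + 1 : ℕ) : ℝ) - ((t * (a / t) + (t - 1) + 1 : ℕ) : ℝ)| ≤ t := by
  have key : a + 1 ≤ t * (a / t) + (t - 1) + 1 ∧ t * (a / t) + (t - 1) + 1 ≤ a + t := by
    have h1 := Nat.div_add_mod a t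
    have h2 := Nat.mod_lt a ht
    generalize t * (a / t) = q at h1 ⊢
    omega
  have e1 : ((a + 1 : ℕ) : ℝ) ≤ ((t * (a / t) + (t - 1) + 1 : ℕ) : ℝ) := by exact_mod_cast key.1
  have e2 : ((t * (a / t) + (t - 1) + 1 : ℕ) : ℝ) ≤ ((a + t : ℕ) : ℝ) := by exact_mod_cast key.2
  rw [abs_sub_le_iff]
  push_cast at e1 e2 ⊢
  constructor <;> linarith

/-! ### The functions `v ↦ v^{α−1} p_c(v)` -/

/-- `v^{α−1} ≤ 4` for `v ≥ 1/4`, `0 ≤ α ≤ 1`. [folklore] -/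
theorem rpow_sub_one_le_four {v α : ℝ} (hv : 1 / 4 ≤ v) (hα0 : 0 ≤ α) (hα1 : α ≤ 1) : v ^ (α - 1) ≤ 4 := by
  have h4 : (0 : ℝ) < 1 / 4 := by norm_num
  have h4' : (0 : ℝ) ≤ 4 := by norm_num
  calc v ^ (α - 1) ≤ (1 / 4 : ℝ) ^ (α - 1) := Real.rpow_le_rpow_of_nonpos h4 hv (by linarith)
    _ = 4 ^ (1 - α) := by
        rw [one_div, Real.inv_rpow h4', ← Real.rpow_neg h4', neg_sub]
    _ ≤ (4 : ℝ) ^ (1 : ℝ) := Real.rpow_le_rpow_of_exponent_le (by norm_num) (by linarith)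
    _ = 4 := Real.rpow_one 4

/-- One-sided Lipschitz bound: `w^{α−1} − v^{α−1} ≤ 16 |v − w|` for `v, w ≥ 1/4`, `0 ≤ α ≤ 1`
(`w^{α−1} = v^{α−1} (v/w)^{1−α}` with `v^{α−1} ≤ 4` and `(v/w)^{1−α} − 1 ≤ v/w − 1 ≤ 4(v − w)` when `v ≥ w`).
[folklore] -/
theorem rpow_sub_one_sub_le {v w α : ℝ} (hv : 1 / 4 ≤ v) (hw : 1 / 4 ≤ w) (hα0 : 0 ≤ α) (hα1 : α ≤ 1) :
    w ^ (α - 1) - v ^ (α - 1) ≤ 16 * |v - w| := by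
  have hv0 : 0 < v := by linarith
  have hw0 : 0 < w := by linarith
  have key : w ^ (α - 1) = v ^ (α - 1) * (v / w) ^ (1 - α) := by
    rw [Real.div_rpow hv0.le hw0.le, mul_div_assoc', ← Real.rpow_add hv0, show α - 1 + (1 - α) = (0 : ℝ) by ring,
      Real.rpow_zero, one_div, ← Real.rpow_neg hw0.le, neg_sub]
  have hv4 : v ^ (α - 1) ≤ 4 := rpow_sub_one_le_four hv hα0 hα1
  have hvpos : 0 ≤ v ^ (α - 1) := Real.rpow_nonneg hv0.le _
  have e : w ^ (α - 1) - v ^ (α - 1) = v ^ (α - 1) * ((v / w) ^ (1 - α) - 1) := by rw [key]; ring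
  rw [e]
  rcases le_or_gt w v with hwv | hvw
  · have h1 : 1 ≤ v / w := (one_le_div hw0).mpr hwv
    have h2 : (v / w) ^ (1 - α) ≤ v / w := by
      calc (v / w) ^ (1 - α) ≤ (v / w) ^ (1 : ℝ) := Real.rpow_le_rpow_of_exponent_le h1 (by linarith)
        _ = v / w := Real.rpow_one _
    have h3 : v / w - 1 = (v - w) / w := by field_simp
    have h4 : (v - w) / w ≤ 4 * (v - w) := by
      rw [div_le_iff₀ hw0]
      nlinarith
    have h5 : 0 ≤ (v / w) ^ (1 - α) - 1 := by linarith [Real.one_le_rpow h1 (by linarith : (0 : ℝ) ≤ 1 - α)]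
    calc v ^ (α - 1) * ((v / w) ^ (1 - α) - 1) ≤ 4 * (4 * (v - w)) :=
          mul_le_mul hv4 (by linarith) h5 (by norm_num)
      _ = 16 * (v - w) := by ring
      _ ≤ 16 * |v - w| := by gcongr; exact le_abs_self _
  · have h1 : (v / w) ^ (1 - α) ≤ 1 :=
      Real.rpow_le_one (div_nonneg hv0.le hw0.le) ((div_le_one hw0).mpr hvw.le) (by linarith)
    calc v ^ (α - 1) * ((v / w) ^ (1 - α) - 1) ≤ 0 := mul_nonpos_of_nonneg_of_nonpos hvpos (by linarith)
      _ ≤ 16 * |v - w| := by positivity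

/-- `|v^{α−1} − w^{α−1}| ≤ 16 |v − w|` for `v, w ≥ 1/4`, `0 ≤ α ≤ 1`. [folklore] -/
theorem abs_rpow_sub_one_sub_le {v w α : ℝ} (hv : 1 / 4 ≤ v) (hw : 1 / 4 ≤ w) (hα0 : 0 ≤ α) (hα1 : α ≤ 1) :
    |v ^ (α - 1) - w ^ (α - 1)| ≤ 16 * |v - w| := by
  rw [abs_sub_le_iff]
  constructor
  · have h := rpow_sub_one_sub_le hw hv hα0 hα1
    rwa [abs_sub_comm] at h
  · exact rpow_sub_one_sub_le hv hw hα0 hα1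

/-- **Sup bound**: if `p_c = 0` on `v ≤ 1/4` and `|p_c| ≤ 1` then `‖v^{α−1} p_c(v)‖ ≤ 4` (`0 ≤ α ≤ 1`). [folklore] -/
theorem norm_rpow_mul_profileFn_le {c : ℤ → ℂ} {α : ℝ} (h0 : ∀ v : ℝ, v ≤ 1 / 4 → profileFn c v = 0)
    (h1 : ∀ v, ‖profileFn c v‖ ≤ 1) (hα0 : 0 ≤ α) (hα1 : α ≤ 1) (v : ℝ) :
    ‖(((v ^ (α - 1) : ℝ)) : ℂ) * profileFn c v‖ ≤ 4 := by
  rcases le_or_gt v (1 / 4) with hv | hv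
  · rw [h0 v hv, mul_zero, norm_zero]
    norm_num
  · rw [norm_mul, Complex.norm_real, Real.norm_eq_abs, abs_of_nonneg (Real.rpow_nonneg (by linarith) _)]
    calc v ^ (α - 1) * ‖profileFn c v‖ ≤ 4 * 1 :=
          mul_le_mul (rpow_sub_one_le_four hv.le hα0 hα1) (h1 v) (norm_nonneg _) (by norm_num)
      _ = 4 := mul_one _

/-- A Lipschitz constant is nonnegative. [folklore] -/
theorem lipschitz_const_nonneg {c : ℤ → ℂ} {L : ℝ} (hL : ∀ v w, ‖profileFn c v - profileFn c w‖ ≤ L * |v - w|) :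
    0 ≤ L := by
  have h := hL 1 0
  rw [sub_zero, abs_one, mul_one] at h
  exact (norm_nonneg _).trans h

/-- **Lipschitz bound**: if moreover `p_c` is `L`-Lipschitz then `v ↦ v^{α−1} p_c(v)` is `(4L + 16)`-Lipschitz on
`ℝ` (cases according to the position of `v, w` relative to `1/4`). [folklore] -/
theorem norm_rpow_mul_profileFn_sub_le {c : ℤ → ℂ} {α L : ℝ} (h0 : ∀ v : ℝ, v ≤ 1 / 4 → profileFn c v = 0)
    (h1 : ∀ v, ‖profileFn c v‖ ≤ 1) (hL : ∀ v w, ‖profileFn c v - profileFn c w‖ ≤ L * |v - w|)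
    (hα0 : 0 ≤ α) (hα1 : α ≤ 1) (v w : ℝ) :
    ‖(((v ^ (α - 1) : ℝ)) : ℂ) * profileFn c v - (((w ^ (α - 1) : ℝ)) : ℂ) * profileFn c w‖ ≤
      (4 * L + 16) * |v - w| := by
  have hL0 : 0 ≤ L := lipschitz_const_nonneg hL
  have one_side : ∀ v w : ℝ, 1 / 4 < v → w ≤ 1 / 4 →
      ‖(((v ^ (α - 1) : ℝ)) : ℂ) * profileFn c v - (((w ^ (α - 1) : ℝ)) : ℂ) * profileFn c w‖ ≤
        (4 * L + 16) * |v - w| := by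
    intro v w hv hw
    rw [h0 w hw, mul_zero, sub_zero, norm_mul, Complex.norm_real, Real.norm_eq_abs,
      abs_of_nonneg (Real.rpow_nonneg (by linarith) _)]
    have hp : ‖profileFn c v‖ ≤ L * |v - w| := by
      have h := hL v w
      rwa [h0 w hw, sub_zero] at h
    calc v ^ (α - 1) * ‖profileFn c v‖ ≤ 4 * (L * |v - w|) :=
          mul_le_mul (rpow_sub_one_le_four hv.le hα0 hα1) hp (norm_nonneg _) (by norm_num)
      _ ≤ (4 * L + 16) * |v - w| := by nlinarith [abs_nonneg (v - w)]
  rcases le_or_gt v (1 / 4) with hv | hv <;> rcases le_or_gt w (1 / 4) with hw | hw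
  · rw [h0 v hv, h0 w hw, mul_zero, mul_zero, sub_zero, norm_zero]
    positivity
  · rw [norm_sub_rev, abs_sub_comm]
    exact one_side w v hw hv
  · exact one_side v w hv hw
  · have hw0 : (0 : ℝ) ≤ w ^ (α - 1) := Real.rpow_nonneg (by linarith) _
    have e : (((v ^ (α - 1) : ℝ)) : ℂ) * profileFn c v - (((w ^ (α - 1) : ℝ)) : ℂ) * profileFn c w =
        (((v ^ (α - 1) - w ^ (α - 1) : ℝ)) : ℂ) * profileFn c v +
          (((w ^ (α - 1) : ℝ)) : ℂ) * (profileFn c v - profileFn c w) := by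
      push_cast
      ring
    rw [e]
    refine (norm_add_le _ _).trans ?_
    rw [norm_mul, norm_mul, Complex.norm_real, Complex.norm_real, Real.norm_eq_abs, Real.norm_eq_abs,
      abs_of_nonneg hw0]
    have h2 := abs_rpow_sub_one_sub_le hv.le hw.le hα0 hα1
    have h3 := rpow_sub_one_le_four hw.le hα0 hα1
    calc |v ^ (α - 1) - w ^ (α - 1)| * ‖profileFn c v‖ + w ^ (α - 1) * ‖profileFn c v - profileFn c w‖
        ≤ 16 * |v - w| * 1 + 4 * (L * |v - w|) :=
          add_le_add (mul_le_mul h2 (h1 v) (norm_nonneg _) (by positivity))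
            (mul_le_mul h3 (hL v w) (norm_nonneg _) (by norm_num))
      _ = (4 * L + 16) * |v - w| := by ring

/-! ### Differences of three-factor products -/

/-- `‖a b c̄ − a' b' c̄'‖ ≤ 16 (‖a − a'‖ + ‖b − b'‖ + ‖c − c'‖)` when `‖b‖, ‖c‖, ‖a'‖, ‖b'‖ ≤ 4`. [folklore] -/
theorem norm_mul_mul_conj_sub_le {a a' b b' c c' : ℂ} (hb : ‖b‖ ≤ 4) (hc : ‖c‖ ≤ 4) (ha' : ‖a'‖ ≤ 4)
    (hb' : ‖b'‖ ≤ 4) :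
    ‖a * b * starRingEnd ℂ c - a' * b' * starRingEnd ℂ c'‖ ≤ 16 * (‖a - a'‖ + ‖b - b'‖ + ‖c - c'‖) := by
  have e : a * b * starRingEnd ℂ c - a' * b' * starRingEnd ℂ c' =
      (a - a') * b * starRingEnd ℂ c + a' * (b - b') * starRingEnd ℂ c + a' * b' * starRingEnd ℂ (c - c') := by
    rw [map_sub]
    ring
  rw [e]
  refine (norm_add₃_le ..).trans ?_
  simp only [norm_mul, Complex.norm_conj]
  have hbc : ‖b‖ * ‖c‖ ≤ 16 := (mul_le_mul hb hc (norm_nonneg _) (by norm_num)).trans (by norm_num)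
  have hac : ‖a'‖ * ‖c‖ ≤ 16 := (mul_le_mul ha' hc (norm_nonneg _) (by norm_num)).trans (by norm_num)
  have hab : ‖a'‖ * ‖b'‖ ≤ 16 := (mul_le_mul ha' hb' (norm_nonneg _) (by norm_num)).trans (by norm_num)
  calc ‖a - a'‖ * ‖b‖ * ‖c‖ + ‖a'‖ * ‖b - b'‖ * ‖c‖ + ‖a'‖ * ‖b'‖ * ‖c - c'‖
      = ‖a - a'‖ * (‖b‖ * ‖c‖) + ‖b - b'‖ * (‖a'‖ * ‖c‖) + ‖c - c'‖ * (‖a'‖ * ‖b'‖) := by ring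
    _ ≤ ‖a - a'‖ * 16 + ‖b - b'‖ * 16 + ‖c - c'‖ * 16 := by gcongr
    _ = 16 * (‖a - a'‖ + ‖b - b'‖ + ‖c - c'‖) := by ring

/-- **Oscillation of the model term.**  For functions `g_i` bounded by `4` and `Lg`-Lipschitz, scales `X_i > 0`,
dilations `d₁, d₂ ≥ 0`, `|σ| ≤ 1`, and `|u₁ − u₁'|, |u₂ − u₂'| ≤ T`:
`‖g₁(u₁/X₁) g₂(u₂/X₂) conj g₃((d₁u₁+σd₂u₂)/X₃) − (same at u')‖ ≤ 16 Lg T (1/X₁ + 1/X₂ + (d₁+d₂)/X₃)`. [folklore] -/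
theorem norm_gTerm_sub_le {g₁ g₂ g₃ : ℝ → ℂ} {Lg : ℝ} (hLg : 0 ≤ Lg)
    (hb₁ : ∀ v, ‖g₁ v‖ ≤ 4) (hb₂ : ∀ v, ‖g₂ v‖ ≤ 4) (hb₃ : ∀ v, ‖g₃ v‖ ≤ 4)
    (hl₁ : ∀ v w, ‖g₁ v - g₁ w‖ ≤ Lg * |v - w|) (hl₂ : ∀ v w, ‖g₂ v - g₂ w‖ ≤ Lg * |v - w|)
    (hl₃ : ∀ v w, ‖g₃ v - g₃ w‖ ≤ Lg * |v - w|)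
    {X₁ X₂ X₃ : ℝ} (hX₁ : 0 < X₁) (hX₂ : 0 < X₂) (hX₃ : 0 < X₃) (d₁ d₂ : ℕ) {σ T : ℝ} (hσ : |σ| ≤ 1)
    {u₁ u₁' u₂ u₂' : ℝ} (hu₁ : |u₁ - u₁'| ≤ T) (hu₂ : |u₂ - u₂'| ≤ T) :
    ‖g₁ (u₁ / X₁) * g₂ (u₂ / X₂) * starRingEnd ℂ (g₃ ((d₁ * u₁ + σ * (d₂ * u₂)) / X₃)) -
        g₁ (u₁' / X₁) * g₂ (u₂' / X₂) * starRingEnd ℂ (g₃ ((d₁ * u₁' + σ * (d₂ * u₂')) / X₃))‖ ≤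
      16 * Lg * T * (1 / X₁ + 1 / X₂ + (d₁ + d₂) / X₃) := by
  have hT : 0 ≤ T := (abs_nonneg _).trans hu₁
  refine (norm_mul_mul_conj_sub_le (hb₂ _) (hb₃ _) (hb₁ _) (hb₂ _)).trans ?_
  have e₁ : ‖g₁ (u₁ / X₁) - g₁ (u₁' / X₁)‖ ≤ Lg * T / X₁ := by
    refine (hl₁ _ _).trans ?_
    rw [← sub_div, abs_div, abs_of_pos hX₁, ← mul_div_assoc]
    gcongr
  have e₂ : ‖g₂ (u₂ / X₂) - g₂ (u₂' / X₂)‖ ≤ Lg * T / X₂ := by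
    refine (hl₂ _ _).trans ?_
    rw [← sub_div, abs_div, abs_of_pos hX₂, ← mul_div_assoc]
    gcongr
  have e₃ : ‖g₃ ((d₁ * u₁ + σ * (d₂ * u₂)) / X₃) - g₃ ((d₁ * u₁' + σ * (d₂ * u₂')) / X₃)‖ ≤
      Lg * ((d₁ + d₂) * T) / X₃ := by
    refine (hl₃ _ _).trans ?_
    rw [← sub_div, abs_div, abs_of_pos hX₃, ← mul_div_assoc]
    gcongr
    calc |d₁ * u₁ + σ * (d₂ * u₂) - (d₁ * u₁' + σ * (d₂ * u₂'))|
        = |d₁ * (u₁ - u₁') + σ * (d₂ * (u₂ - u₂'))| := by congr 1; ring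
      _ ≤ |d₁ * (u₁ - u₁')| + |σ * (d₂ * (u₂ - u₂'))| := abs_add_le _ _
      _ = d₁ * |u₁ - u₁'| + |σ| * (d₂ * |u₂ - u₂'|) := by
          rw [abs_mul, abs_mul, abs_mul, Nat.abs_cast, Nat.abs_cast]
      _ ≤ d₁ * T + 1 * (d₂ * T) := by gcongr
      _ = (d₁ + d₂) * T := by ring
  calc 16 * (‖g₁ (u₁ / X₁) - g₁ (u₁' / X₁)‖ + ‖g₂ (u₂ / X₂) - g₂ (u₂' / X₂)‖ +
        ‖g₃ ((d₁ * u₁ + σ * (d₂ * u₂)) / X₃) - g₃ ((d₁ * u₁' + σ * (d₂ * u₂')) / X₃)‖)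
      ≤ 16 * (Lg * T / X₁ + Lg * T / X₂ + Lg * ((d₁ + d₂) * T) / X₃) := by linarith
    _ = 16 * Lg * T * (1 / X₁ + 1 / X₂ + (d₁ + d₂) / X₃) := by ring

/-! ### The model weights in `g`-form -/

variable {c : ℤ → ℂ}

/-- `μ(n) = (Mv/X) · g(n/X)` with `g(v) = v^{α−1} p_c(v)`. [folklore] -/
theorem profileModelWeight_eq_mul_rpow_mul (c : ℤ → ℂ) (Mv X α : ℝ) (n : ℕ) :
    profileModelWeight c Mv X α n =
      ((Mv / X : ℝ) : ℂ) * (((((n : ℝ) / X) ^ (α - 1) : ℝ) : ℂ) * profileFn c ((n : ℝ) / X)) := by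
  unfold profileModelWeight
  push_cast
  ring

/-- **Size of the weights**: `‖μ(n)‖ ≤ 4 Mv/X` when `p_c = 0` on `v ≤ 1/4`, `|p_c| ≤ 1`, `0 ≤ α ≤ 1`, `Mv ≥ 0`,
`X > 0`. [folklore] -/
theorem norm_profileModelWeight_le_four_mul {Mv X α : ℝ} (h0 : ∀ v : ℝ, v ≤ 1 / 4 → profileFn c v = 0)
    (h1 : ∀ v, ‖profileFn c v‖ ≤ 1) (hα0 : 0 ≤ α) (hα1 : α ≤ 1) (hMv : 0 ≤ Mv) (hX : 0 < X) (n : ℕ) :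
    ‖profileModelWeight c Mv X α n‖ ≤ 4 * (Mv / X) := by
  rw [profileModelWeight_eq_mul_rpow_mul, norm_mul, Complex.norm_real, Real.norm_eq_abs,
    abs_of_nonneg (div_nonneg hMv hX.le)]
  calc Mv / X * ‖(((((n : ℝ) / X) ^ (α - 1) : ℝ) : ℂ) * profileFn c ((n : ℝ) / X))‖ ≤ Mv / X * 4 :=
        mul_le_mul_of_nonneg_left (norm_rpow_mul_profileFn_le h0 h1 hα0 hα1 _) (div_nonneg hMv hX.le)
    _ = 4 * (Mv / X) := mul_comm _ _

end SmoothArcs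

end Literature.NumberTheory.Sieve

end
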